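import Summits.NavierStokesRegularity.NavierStokesRegularity.Theorems.StableStrataDoorOneSliceAxiSeq
import Summits.NavierStokesRegularity.NavierStokesRegularity.Theorems.StableStrataDoorAlongTimes

/-!
# StableStrataDoorOneSliceSeqHolds — SEED-26 «the SEQUENTIAL ε-door» of door S26 «StableStrataDoor»: the doors
**T-axi-seq** and **T-quiet-seq** HOLD UNCONDITIONALLY (I1 `LocalPointZoomAlongTimesM` is the tree theorem
`StableStrataDoorAlongTimes.localPointZoomAlongTimesM_holds`, nsreg-p6 g14)

The consumer `StableStrataDoorOneSliceAxiSeq` (ns-door-S23-p1 g3) proved both sequential doors modulo I1 only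
(`targetSeqAxisymAt_of_zoom`, `seqDoorAt_quiet`); with I1 landed they are theorems:

* **`targetSeqAxisymAt_holds (hν : 0 < ν) (A) : TargetSeqAxisymAt ν M A`** and its closure `targetSeqAxisym_holds` — DOOR
  T-axi-seq «for every viscosity `ν > 0`, local Type-I bound `M`, axis `A e₃` and bounded open window `U ≠ ∅` some
  `ε(ν, M, A, U) > 0` makes "space–time local Type I (`M`) at `(x₀,T)` + axisymmetry defect about `x₀ + ℝ·A e₃` at most `ε`
  on `U` at every angle ALONG SOME SEQUENCE `tₙ → T⁻`" impossible at a singular point» — a Type-I blow-up keeps a UNIFORM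
  `L¹(U)`-distance from axisymmetry about every axis as `t → T⁻`;
* **`seqDoorAt_quiet_holds (hν) (hU) (hne) : SeqDoorAt (quietPhi U) ν M`** — DOOR T-quiet-seq «no Type-I blow-up whose
  similarity window is ε-quiet along SOME sequence of times».

(S26's eventual doors T-axi `targetEpsAxisym_holds` / T-quiet `targetQuietWindow_holds` follow again via
`targetEpsAxisymAt_of_seq` / `eventualDoor_of_seqDoor`; not restated.)  Design: nsreg-p1 g21 ADDENDUM-25A /
`r25/seed26/Sketch26A.lean` v5 (bb69eb44dfa09fc3).  Door family of LADDER-NS N0 (door S26 / SEED-26;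
`--supports stmt-NavierStokesRegularity-0056`, helper lane ns-door-S23-p1).  No route, no items.
WHAT THIS IS NOT: not NS regularity (Clay (A)) and not a dent in `NoTypeII` (stmt-0056) — ε-criteria INSIDE the Type-I
class (every statement carries the space–time local Type-I hypothesis); not the swirl hard cores; `ε` comes from
compactness and is NOT explicit.
-/

noncomputable section

set_option linter.dupNamespace false

namespace Summit.NavierStokesRegularity.NavierStokesRegularity.Theorems.StableStrataDoorOneSliceSeqHolds

open Set Topology
open Summit.NavierStokesRegularity.NavierStokesRegularity.Theorems.StableStrataDoorInstances
open Summit.NavierStokesRegularity.NavierStokesRegularity.Theorems.StableStrataDoorOneSliceSeqDoor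
open Summit.NavierStokesRegularity.NavierStokesRegularity.Theorems.StableStrataDoorOneSliceAxiSeq
open Summit.NavierStokesRegularity.NavierStokesRegularity.Theorems.StableStrataDoorAlongTimes

/-- **DOOR T-axi-seq HOLDS** at every `ν > 0`, every `M`, every axis `A e₃`. -/
theorem targetSeqAxisymAt_holds {ν M : ℝ} (hν : 0 < ν) (A : EuclideanSpace ℝ (Fin 3) ≃ₗᵢ[ℝ] EuclideanSpace ℝ (Fin 3)) :
    TargetSeqAxisymAt ν M A :=
  targetSeqAxisymAt_of_zoom hν A localPointZoomAlongTimesM_holds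

/-- **DOOR T-axi-seq, all constants and all axes.** -/
theorem targetSeqAxisym_holds :
    ∀ (ν M : ℝ) (A : EuclideanSpace ℝ (Fin 3) ≃ₗᵢ[ℝ] EuclideanSpace ℝ (Fin 3)), 0 < ν → TargetSeqAxisymAt ν M A :=
  fun _ _ A hν => targetSeqAxisymAt_holds hν A

/-- **DOOR T-quiet-seq HOLDS**: for every `ν > 0`, `M` and open nonempty window `U`, `SeqDoorAt (quietPhi U) ν M`. -/
theorem seqDoorAt_quiet_holds {ν M : ℝ} (hν : 0 < ν) {U : Set (EuclideanSpace ℝ (Fin 3))} (hU : IsOpen U)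
    (hne : U.Nonempty) : SeqDoorAt (quietPhi U) ν M :=
  seqDoorAt_quiet localPointZoomAlongTimesM_holds hν hU hne

end Summit.NavierStokesRegularity.NavierStokesRegularity.Theorems.StableStrataDoorOneSliceSeqHolds
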